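import Summits.BirchSwinnertonDyer.BirchSwinnertonDyer.Theorems.ByReductionTypeAtTwoSupersingularTwoCongruenceMuTransportLower
import Summits.BirchSwinnertonDyer.BirchSwinnertonDyer.Theorems.ThetaPartnerAtTwoSignedTransportAtTwoSplitGlue
import Summits.BirchSwinnertonDyer.BirchSwinnertonDyer.Theorems.ThetaPartnerAtTwoSignedTransportAtTwoStubSel2Tb
import HarnessLib

/-!
# The `μ`-TRANSPORT AT `2` ALONG A `2`-CONGRUENCE, CM-FREE — part 2 (the pair): finiteness of `Sel⁺[2]` and then `Λ`-torsion with
# `μ = 0` transport from `A` to `W` for ANY two globally minimal elliptic curves over `ℚ` good supersingular at `2` with `a₂ = 0`,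
# `Δ_W < 0`, along a Galois-equivariant `W[2] ≃ A[2]` (seat `bsd-2adic-ss-1x` GEN 6; crux `SupersingularRankZeroAtTwo` 19097,
# unit-anchor road; generalises the kernel transport on the TP2 habitat of `…ThetaHabitatMTTP2Items` p584588 off the CM partner)

HONEST FRAMING (cells `bsd-2adic` / `bsd-wall`): THEOREMS ONLY — no definition, no named fact, no instance, no `sorry`. Every proof here
is the corresponding proof of route TP2's lead (files `…StubSel2U` p550799, `…StubSel2Tb` p570334, `…SplitGlue` p572666, lead
bsd-wall-tp2-p1) COPIED VERBATIM with the habitat prefix removed: those landed statements quantify over the theta habitat (`W` non-CM of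
analytic rank `0`, `A` CM) but their proofs use only «both curves good supersingular at `2` with `a₂ = 0`» (Honda transport), «`Δ_W < 0`»
(the archimedean residual condition is vacuous — on the habitat it came from `Δ_neg_of_cmPartner_two`) and the equivariant `W[2] ≃ A[2]`.
Nothing about BSD; closes nothing; BSD is NOT proved by any of this. PARTITION (D-0054): X5@2 good-ss `a₂ = 0` × `p = 2` —
types-the-object-of (the binder `hmuT` of the UNIT-ANCHOR Λ-form displays, 17 classes, becomes a kernel term on the `Δ_E < 0` classes);
bears_on: K4 19097 · TP2 20333 (K1; nothing of TP2 is changed or claimed).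

* `sel2U_negDisc`, `sel2Tb_cmFree`, `sel2Ta_cmFree`, `sel2T_cmFree`, `sel2L_cmFree`, `sel2_cmFree_negDisc` — the prefix-free devissage;
* `isTorsion_and_mu_eq_zero_of_twoCongruence_negDisc` — `X⁺_A` torsion with `μ = 0` ⇒ `X⁺_W` torsion with `μ = 0`;
* `muTransport_two_of_twoCongruence_negDisc` — the UA doors' binder `hmuT`, verbatim shape, as a kernel term for `Δ_E < 0`.

References: [BDKim2009] Prop. 2.9–2.12, Cor. 2.13; [GreenbergVatsal2000] Thm. (1.4), Prop. (2.8); [Kobayashi2003] Def. 1.1, §8;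
[Matsuno2008] Thm. 4.2 (the `Δ < 0` device at `p = 2`).
-/

set_option autoImplicit false
-- D-0017: single-problem summit, so `Summit.BirchSwinnertonDyer.BirchSwinnertonDyer.…` repeats a namespace BY DESIGN.
set_option linter.dupNamespace false

noncomputable section

open scoped Classical MatrixGroups ModularForm BigOperators AddSubgroup NNReal

open CongruenceSubgroup Polynomial WeierstrassCurve NumberField IsDedekindDomain Rat.HeightOneSpectrum
  Literature Literature.NumberTheory.EllipticCurves Literature.NumberTheory.EllipticCurves.IwasawaAlgebra
  Literature.NumberTheory.EllipticCurves.ModularForms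
  Literature.NumberTheory.EllipticCurves.Rank1Residual
  Literature.NumberTheory.EllipticCurves.Kobayashi2003 ZpExtension
  Literature.NumberTheory.EllipticCurves.GreenbergVatsal2000
  Literature.NumberTheory.EllipticCurves.Sprung2017
  Literature.NumberTheory.GaloisRepresentations
  Summit.BirchSwinnertonDyer.Rank1Residual.X1.MuLambda
  Summit.BirchSwinnertonDyer.Rank1Residual.Supersingular
  Summit.BirchSwinnertonDyer.Rank1Residual.X2.EulerFactorInvariants
  Summit.BirchSwinnertonDyer.Rank1Residual.Additive
  Summit.BirchSwinnertonDyer.BirchSwinnertonDyer.Theorems.TwoAdicTwistConverse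
  Summit.BirchSwinnertonDyer.BirchSwinnertonDyer.Theorems.FineSelmerLeSignedSelmer Field

namespace Summit.BirchSwinnertonDyer.BirchSwinnertonDyer.Theorems.SignedTransportAtTwo
namespace TwoCongruence

universe u

/-! ## The prefix-free devissage -/

/-- **UPPER containment of the residual devissage at `2` for `Δ_W < 0`, CM-FREE** (the landed `stub_sel2U`, p550799, whose only use
of the CM partner was `Δ_W < 0` via `Δ_neg_of_cmPartner_two`; proof otherwise VERBATIM the lead's): every residual class whose Kummer
image lies in `Sel⁺(W/ℚ_∞)` is unramified outside `S₀ ∪ {2}` (`S₀ ⊇` bad places), residually trivial at `∞` (`Δ_W < 0`), and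
signed-Kummer above `2`. [cite: GreenbergVatsal2000, p. 3 and Prop. (2.8)] [cite: BDKim2009, Prop. 2.10] [cite: Kobayashi2003, Def. 1.1] -/
theorem sel2U_negDisc :
    ∀ (W : WeierstrassCurve ℚ) [W.IsElliptic] [W.IsGloballyMinimal], W.Δ < 0 →
    ∀ (κ : ZpExtension ℚ 2), κ.IsCyclotomic →
    ∀ (S₀ : Finset (HeightOneSpectrum (𝓞 ℚ))),
      (∀ v : HeightOneSpectrum (𝓞 ℚ), ¬ W.HasGoodReductionAt v → v ∈ S₀) →
    ∀ c : subgroupH1 κ.kerSubgroup ↥((↥(W.geomPrimaryTorsion 2))[(2 : ℤ)]),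
      pushH1 κ.kerSubgroup ((↥(W.geomPrimaryTorsion 2))[(2 : ℤ)]).subtype (subtype_torsionBy_smul W 2) c ∈
          signedSelmerInfty W κ 1 →
      c ∈ unramifiedOutside κ.kerSubgroup ↥((↥(W.geomPrimaryTorsion 2))[(2 : ℤ)]) 2
          (↑S₀ : Set (HeightOneSpectrum (𝓞 ℚ))) ∧
        (∀ (w : InfinitePlace ℚ) (σ : Field.absoluteGaloisGroup ℚ),
          Literature.NumberTheory.EllipticCurves.conjH1 κ.kerSubgroup ↥((↥(W.geomPrimaryTorsion 2))[(2 : ℤ)]) σ c ∈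
            GreenbergSelmer.infKer κ.kerSubgroup ↥((↥(W.geomPrimaryTorsion 2))[(2 : ℤ)]) w) ∧
        (∀ (v : HeightOneSpectrum (𝓞 ℚ)), ((2 : ℕ) : 𝓞 ℚ) ∈ v.asIdeal → ∀ σ : Field.absoluteGaloisGroup ℚ,
          W.conjH1 2 κ.kerSubgroup σ
              (pushH1 κ.kerSubgroup ((↥(W.geomPrimaryTorsion 2))[(2 : ℤ)]).subtype (subtype_torsionBy_smul W 2) c) ∈
            localKummerOverOfEmb W 2 κ.kerSubgroup (closureEmb (K := ℚ) (v.adicCompletion ℚ))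
              (⨆ n : ℕ, signedLocalPoints κ (v.adicCompletion ℚ) W 1 n)) := by
  intro W _ _ hΔ κ hκ S₀ hSW c hc
  -- the Kummer image lies in the classical Selmer group over `ℚ_∞`
  have hSel : pushH1 κ.kerSubgroup ((↥(W.geomPrimaryTorsion 2))[(2 : ℤ)]).subtype (subtype_torsionBy_smul W 2) c ∈
      W.selmerInfty κ := signedSelmerInfty_le_selmerInfty W κ 1 hc
  have hSel' := (W.mem_selmerGroupOver_iff 2 κ.kerSubgroup _).mp hSel
  -- conjugation commutes with the Kummer map
  have hconj : ∀ σ : Field.absoluteGaloisGroup ℚ,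
      W.conjH1 2 κ.kerSubgroup σ
          (pushH1 κ.kerSubgroup ((↥(W.geomPrimaryTorsion 2))[(2 : ℤ)]).subtype (subtype_torsionBy_smul W 2) c) =
        pushH1 κ.kerSubgroup ((↥(W.geomPrimaryTorsion 2))[(2 : ℤ)]).subtype (subtype_torsionBy_smul W 2)
          (Literature.NumberTheory.EllipticCurves.conjH1 κ.kerSubgroup ↥((↥(W.geomPrimaryTorsion 2))[(2 : ℤ)]) σ c) :=
    fun σ ↦ (pushH1_conjH1 κ.kerSubgroup ((↥(W.geomPrimaryTorsion 2))[(2 : ℤ)]).subtype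
      (subtype_torsionBy_smul W 2) σ c).symm
  refine ⟨?_, ?_, ?_⟩
  · -- (a) unramified outside `S₀ ∪ {2}`
    rw [mem_unramifiedOutside_iff]
    intro v hvS hv2 σ
    have hgood : W.HasGoodReductionAt v := by
      by_contra h; exact hvS (hSW v h)
    have h := hSel'.1 v σ
    rw [hconj σ] at h
    exact mem_unramifiedKer_of_pushH1_mem_localKerOver W 2 κ.kerSubgroup hgood hv2 _ h
  · -- (b) residually trivial at the real place
    intro w σ
    have h := hSel'.2 w σ
    rw [hconj σ] at h
    exact mem_infKer_of_pushH1_mem_localKerOver_of_Δ_neg W κ.kerSubgroup hΔ w _ h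
  · -- (c) the signed Kummer condition at `2` over `ℚ_∞`
    intro v hv σ
    exact conjH1_mem_localKummerOverOfEmb_iSup_of_mem_signedSelmerInfty W κ 1 hc v hv σ

/-- **The local transport at `2`, CM-FREE** (the landed `stub_sel2Tb`, p570334, prefix-free; proof VERBATIM the lead's, from
`exists_equivariant_hom_of_algebra`): for ANY two globally minimal elliptic curves good supersingular at `2` with `a₂ = 0` and an
equivariant `ẽ : W[2^∞][2] ≃ A[2^∞][2]`, at the place above `2` there is a `Gal(ℚ̄₂/ℚ₂)`-equivariant `Ψ : W(ℚ̄₂) → A(ℚ̄₂)` restricting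
to `ẽ` (both formal groups of Honda type `X² + 2`). [cite: BDKim2009, Prop. 2.11–2.12 (p. 186)] -/
theorem sel2Tb_cmFree :
    ∀ (W : WeierstrassCurve ℚ) [W.IsElliptic] [W.IsGloballyMinimal] (A : WeierstrassCurve ℚ) [A.IsElliptic]
      [A.IsGloballyMinimal], GoodSS W 2 → W.frobeniusTrace 2 = 0 → GoodSS A 2 → A.frobeniusTrace 2 = 0 →
    ∀ (κ : ZpExtension ℚ 2), κ.IsCyclotomic →
    ∀ (e' : ↥((↥(W.geomPrimaryTorsion 2))[(2 : ℤ)]) ≃+ ↥((↥(A.geomPrimaryTorsion 2))[(2 : ℤ)]))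
      (he' : ∀ (σ : Field.absoluteGaloisGroup ℚ) (x : ↥((↥(W.geomPrimaryTorsion 2))[(2 : ℤ)])), e' (σ • x) = σ • e' x),
    ∀ (v : HeightOneSpectrum (𝓞 ℚ)), ((2 : ℕ) : 𝓞 ℚ) ∈ v.asIdeal →
    ∃ Ψ : localPoints W (v.adicCompletion ℚ) →+ localPoints A (v.adicCompletion ℚ),
      (∀ (τ : Field.absoluteGaloisGroup (v.adicCompletion ℚ)) (P : localPoints W (v.adicCompletion ℚ)),
          Ψ (τ • P) = τ • Ψ P) ∧
      (∀ x : ↥((↥(W.geomPrimaryTorsion 2))[(2 : ℤ)]),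
        Ψ (pointsMapOfEmb W (closureEmb (K := ℚ) (v.adicCompletion ℚ)) ((x : W.geomPrimaryTorsion 2) : W.geomPoints)) =
          pointsMapOfEmb A (closureEmb (K := ℚ) (v.adicCompletion ℚ)) ((e' x : A.geomPrimaryTorsion 2) : A.geomPoints)) := by
  intro W _ _ A _ _ hssW ha2W hssA ha2A κ _ e' he' v hv
  obtain ⟨e⟩ := nonempty_algEquiv_padic_adicCompletion (p := 2) (v := v) (by exact_mod_cast hv)
  letI : Algebra ℚ_[2] (v.adicCompletion ℚ) := (e : ℚ_[2] →ₐ[ℚ] v.adicCompletion ℚ).toRingHom.toAlgebra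
  haveI : IsScalarTower ℚ ℚ_[2] (v.adicCompletion ℚ) :=
    IsScalarTower.of_algebraMap_eq fun r ↦ ((e : ℚ_[2] →ₐ[ℚ] v.adicCompletion ℚ).commutes r).symm
  haveI : Algebra.IsAlgebraic ℚ_[2] (v.adicCompletion ℚ) := ⟨fun x ↦ by
    have hx : x = algebraMap ℚ_[2] (v.adicCompletion ℚ) (e.symm x) := (e.apply_symm_apply x).symm
    rw [hx]
    exact isAlgebraic_algebraMap _⟩
  exact exists_equivariant_hom_of_algebra W A (v.adicCompletion ℚ) hssW ha2W hssA ha2A e' he'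

/-- **`Ψ` carries `W⁺(ℚ_{n,2})` into `A⁺(ℚ_{n,2})`, CM-FREE** (= `SplitGlue.sel2Ta_of_Tb` fed `sel2Tb_cmFree`; proof VERBATIM).
[cite: BDKim2009, Prop. 2.11–2.12] [cite: Kobayashi2003, Def. 1.1] -/
theorem sel2Ta_cmFree :
    ∀ (W : WeierstrassCurve ℚ) [W.IsElliptic] [W.IsGloballyMinimal] (A : WeierstrassCurve ℚ) [A.IsElliptic]
      [A.IsGloballyMinimal], GoodSS W 2 → W.frobeniusTrace 2 = 0 → GoodSS A 2 → A.frobeniusTrace 2 = 0 →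
    ∀ (κ : ZpExtension ℚ 2), κ.IsCyclotomic →
    ∀ (e' : ↥((↥(W.geomPrimaryTorsion 2))[(2 : ℤ)]) ≃+ ↥((↥(A.geomPrimaryTorsion 2))[(2 : ℤ)]))
      (he' : ∀ (σ : Field.absoluteGaloisGroup ℚ) (x : ↥((↥(W.geomPrimaryTorsion 2))[(2 : ℤ)])), e' (σ • x) = σ • e' x),
    ∀ (v : HeightOneSpectrum (𝓞 ℚ)), ((2 : ℕ) : 𝓞 ℚ) ∈ v.asIdeal →
    ∃ Ψ : localPoints W (v.adicCompletion ℚ) →+ localPoints A (v.adicCompletion ℚ),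
      (∀ (τ : Field.absoluteGaloisGroup (v.adicCompletion ℚ)) (P : localPoints W (v.adicCompletion ℚ)),
          Ψ (τ • P) = τ • Ψ P) ∧
      (∀ n : ℕ, (signedLocalPoints κ (v.adicCompletion ℚ) W 1 n).map Ψ ≤ signedLocalPoints κ (v.adicCompletion ℚ) A 1 n) ∧
      (∀ x : ↥((↥(W.geomPrimaryTorsion 2))[(2 : ℤ)]),
        Ψ (pointsMapOfEmb W (closureEmb (K := ℚ) (v.adicCompletion ℚ)) ((x : W.geomPrimaryTorsion 2) : W.geomPoints)) =
          pointsMapOfEmb A (closureEmb (K := ℚ) (v.adicCompletion ℚ)) ((e' x : A.geomPrimaryTorsion 2) : A.geomPoints)) := by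
  intro W _ _ A _ _ hssW ha2W hssA ha2A κ hκ e' he' v hv
  obtain ⟨Ψ, hΨ, hΨe⟩ := sel2Tb_cmFree W A hssW ha2W hssA ha2A κ hκ e' he' v hv
  exact ⟨Ψ, hΨ, fun n ↦ map_signedLocalPointsOfEmb_le κ (closureEmb (K := ℚ) (v.adicCompletion ℚ)) W A Ψ hΨ 1 n, hΨe⟩

/-- **Transport of the signed Kummer condition at `2` over `ℚ_∞` along `Ψ`, CM-FREE** (= `SplitGlue.sel2T_of_Ta` fed `sel2Ta_cmFree`;
proof VERBATIM). [cite: BDKim2009, Prop. 2.11–2.12] [cite: Kobayashi2003, Def. 1.1] -/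
theorem sel2T_cmFree :
    ∀ (W : WeierstrassCurve ℚ) [W.IsElliptic] [W.IsGloballyMinimal] (A : WeierstrassCurve ℚ) [A.IsElliptic]
      [A.IsGloballyMinimal], GoodSS W 2 → W.frobeniusTrace 2 = 0 → GoodSS A 2 → A.frobeniusTrace 2 = 0 →
    ∀ (κ : ZpExtension ℚ 2), κ.IsCyclotomic →
    ∀ (e' : ↥((↥(W.geomPrimaryTorsion 2))[(2 : ℤ)]) ≃+ ↥((↥(A.geomPrimaryTorsion 2))[(2 : ℤ)]))
      (he' : ∀ (σ : Field.absoluteGaloisGroup ℚ) (x : ↥((↥(W.geomPrimaryTorsion 2))[(2 : ℤ)])), e' (σ • x) = σ • e' x),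
    ∀ c : subgroupH1 κ.kerSubgroup ↥((↥(W.geomPrimaryTorsion 2))[(2 : ℤ)]),
      (∀ (v : HeightOneSpectrum (𝓞 ℚ)), ((2 : ℕ) : 𝓞 ℚ) ∈ v.asIdeal → ∀ σ : Field.absoluteGaloisGroup ℚ,
          W.conjH1 2 κ.kerSubgroup σ
              (pushH1 κ.kerSubgroup ((↥(W.geomPrimaryTorsion 2))[(2 : ℤ)]).subtype (subtype_torsionBy_smul W 2) c) ∈
            localKummerOverOfEmb W 2 κ.kerSubgroup (closureEmb (K := ℚ) (v.adicCompletion ℚ))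
              (⨆ n : ℕ, signedLocalPoints κ (v.adicCompletion ℚ) W 1 n)) →
      (∀ (v : HeightOneSpectrum (𝓞 ℚ)), ((2 : ℕ) : 𝓞 ℚ) ∈ v.asIdeal → ∀ σ : Field.absoluteGaloisGroup ℚ,
          A.conjH1 2 κ.kerSubgroup σ
              (pushH1 κ.kerSubgroup ((↥(A.geomPrimaryTorsion 2))[(2 : ℤ)]).subtype (subtype_torsionBy_smul A 2)
                (pushH1 κ.kerSubgroup e'.toAddMonoidHom he' c)) ∈
            localKummerOverOfEmb A 2 κ.kerSubgroup (closureEmb (K := ℚ) (v.adicCompletion ℚ))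
              (⨆ n : ℕ, signedLocalPoints κ (v.adicCompletion ℚ) A 1 n)) := by
  intro W _ _ A _ _ hssW ha2W hssA ha2A κ hκ e' he' c hcW v hv σ
  obtain ⟨Ψ, hΨ, hΨplus, hΨe⟩ := sel2Ta_cmFree W A hssW ha2W hssA ha2A κ hκ e' he' v hv
  -- move the conjugation inside both Kummer maps
  have h1 : A.conjH1 2 κ.kerSubgroup σ
      (pushH1 κ.kerSubgroup ((↥(A.geomPrimaryTorsion 2))[(2 : ℤ)]).subtype (subtype_torsionBy_smul A 2)
        (pushH1 κ.kerSubgroup e'.toAddMonoidHom he' c)) =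
      pushH1 κ.kerSubgroup ((↥(A.geomPrimaryTorsion 2))[(2 : ℤ)]).subtype (subtype_torsionBy_smul A 2)
        (Literature.NumberTheory.EllipticCurves.conjH1 κ.kerSubgroup _ σ (pushH1 κ.kerSubgroup e'.toAddMonoidHom he' c)) :=
    (pushH1_conjH1 κ.kerSubgroup ((↥(A.geomPrimaryTorsion 2))[(2 : ℤ)]).subtype (subtype_torsionBy_smul A 2) σ _).symm
  have h2 : Literature.NumberTheory.EllipticCurves.conjH1 κ.kerSubgroup _ σ (pushH1 κ.kerSubgroup e'.toAddMonoidHom he' c) =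
      pushH1 κ.kerSubgroup e'.toAddMonoidHom he'
        (Literature.NumberTheory.EllipticCurves.conjH1 κ.kerSubgroup _ σ c) :=
    (pushH1_conjH1 κ.kerSubgroup e'.toAddMonoidHom he' σ c).symm
  rw [h1, h2]
  have hcW' := hcW v hv σ
  have h3 : W.conjH1 2 κ.kerSubgroup σ
      (pushH1 κ.kerSubgroup ((↥(W.geomPrimaryTorsion 2))[(2 : ℤ)]).subtype (subtype_torsionBy_smul W 2) c) =
      pushH1 κ.kerSubgroup ((↥(W.geomPrimaryTorsion 2))[(2 : ℤ)]).subtype (subtype_torsionBy_smul W 2)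
        (Literature.NumberTheory.EllipticCurves.conjH1 κ.kerSubgroup _ σ c) :=
    (pushH1_conjH1 κ.kerSubgroup ((↥(W.geomPrimaryTorsion 2))[(2 : ℤ)]).subtype (subtype_torsionBy_smul W 2) σ c).symm
  rw [h3] at hcW'
  refine pushH1_mem_localKummerOverOfEmb_of_transport W A 2 κ.kerSubgroup (closureEmb (K := ℚ) (v.adicCompletion ℚ))
    e' he' Ψ hΨ _ _ ?_ hΨe _ hcW'
  rw [AddSubgroup.map_iSup]
  exact iSup_mono fun n ↦ hΨplus n

/-- **`R(A)` finite ⇒ `R♯_{S₀}(A)` finite, CM-FREE, for ANY `A`** (= `SplitGlue.sel2L_of_L0F` fed the prefix-free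
`TwoCongruence.sel2F_cmFree` / `sel2L0_cmFree`). [cite: GreenbergVatsal2000, Prop. (2.8)] [cite: BDKim2009, Prop. 2.10] -/
theorem sel2L_cmFree :
    ∀ (A : WeierstrassCurve ℚ) [A.IsElliptic] [A.IsGloballyMinimal] (κ : ZpExtension ℚ 2), κ.IsCyclotomic →
    ∀ (S₀ : Finset (HeightOneSpectrum (𝓞 ℚ))), (∀ v ∈ S₀, ((2 : ℕ) : 𝓞 ℚ) ∉ v.asIdeal) →
    ((signedSelmerInfty A κ 1).comap
        (pushH1 κ.kerSubgroup ((↥(A.geomPrimaryTorsion 2))[(2 : ℤ)]).subtype (subtype_torsionBy_smul A 2)) :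
          Set (subgroupH1 κ.kerSubgroup ↥((↥(A.geomPrimaryTorsion 2))[(2 : ℤ)]))).Finite →
    {c : subgroupH1 κ.kerSubgroup ↥((↥(A.geomPrimaryTorsion 2))[(2 : ℤ)]) |
      c ∈ unramifiedOutside κ.kerSubgroup ↥((↥(A.geomPrimaryTorsion 2))[(2 : ℤ)]) 2
          (↑S₀ : Set (HeightOneSpectrum (𝓞 ℚ))) ∧
        (∀ (w : InfinitePlace ℚ) (σ : Field.absoluteGaloisGroup ℚ),
          Literature.NumberTheory.EllipticCurves.conjH1 κ.kerSubgroup ↥((↥(A.geomPrimaryTorsion 2))[(2 : ℤ)]) σ c ∈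
            GreenbergSelmer.infKer κ.kerSubgroup ↥((↥(A.geomPrimaryTorsion 2))[(2 : ℤ)]) w) ∧
        (∀ (v : HeightOneSpectrum (𝓞 ℚ)), ((2 : ℕ) : 𝓞 ℚ) ∈ v.asIdeal → ∀ σ : Field.absoluteGaloisGroup ℚ,
          A.conjH1 2 κ.kerSubgroup σ
              (pushH1 κ.kerSubgroup ((↥(A.geomPrimaryTorsion 2))[(2 : ℤ)]).subtype (subtype_torsionBy_smul A 2) c) ∈
            localKummerOverOfEmb A 2 κ.kerSubgroup (closureEmb (K := ℚ) (v.adicCompletion ℚ))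
              (⨆ n : ℕ, signedLocalPoints κ (v.adicCompletion ℚ) A 1 n))}.Finite := by
  intro A _ _ κ hκ S₀ hS2 hRA
  refine TwoCongruence.sel2F_cmFree A κ hκ S₀ hS2 (hRA.subset ?_)
  rintro c ⟨ha, hb, hc⟩
  exact TwoCongruence.sel2L0_cmFree A κ hκ c ha hb hc

/-- **FINITENESS OF `Sel⁺[2]` TRANSPORTS ALONG A `2`-CONGRUENCE, CM-FREE** (= `SplitGlue.sel2_of_UTL` with every TP2 wrapper replaced
by its prefix-free twin; proof VERBATIM): for ANY two globally minimal elliptic curves `W`, `A` over `ℚ`, both good supersingular at `2`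
with `a₂ = 0`, `Δ_W < 0`, and a Galois-equivariant `W[2] ≃ A[2]`: for every cyclotomic `κ`, `Sel⁺(A/ℚ_∞)[2]` finite ⇒
`Sel⁺(W/ℚ_∞)[2]` finite. This is Greenberg–Vatsal Prop. (2.8) / B. D. Kim Prop. 2.9–2.12 READ AT `p = 2` with NO CM and NO
analytic-rank hypothesis. [cite: GreenbergVatsal2000, p. 3 and Prop. (2.8)] [cite: BDKim2009, Prop. 2.9–2.12 and Cor. 2.13] -/
theorem sel2_cmFree_negDisc :
    ∀ (W : WeierstrassCurve ℚ) [W.IsElliptic] [W.IsGloballyMinimal] (A : WeierstrassCurve ℚ) [A.IsElliptic]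
      [A.IsGloballyMinimal], GoodSS W 2 → W.frobeniusTrace 2 = 0 → GoodSS A 2 → A.frobeniusTrace 2 = 0 → W.Δ < 0 →
    (∃ e : WeierstrassCurve.geomTorsion W (2 : ℤ) ≃+ WeierstrassCurve.geomTorsion A (2 : ℤ),
      ∀ (σ : Field.absoluteGaloisGroup ℚ) (P : WeierstrassCurve.geomTorsion W (2 : ℤ)), e (σ • P) = σ • e P) →
    ∀ (κ : ZpExtension ℚ 2), κ.IsCyclotomic →
      {s : signedSelmerInfty A κ 1 | (2 : ℕ) • s = 0}.Finite →
      {s : signedSelmerInfty W κ 1 | (2 : ℕ) • s = 0}.Finite := by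
  intro W _ _ A _ _ hssW ha2W hssA ha2A hΔ he κ hκ hfinA
  obtain ⟨S₀, hS2, hSW, hSA⟩ := exists_admissiblePlaces W A hssW.1 hssA.1
  obtain ⟨e'₀, he'₀, hbij₀⟩ := exists_pushH1_bijective W A 2 κ.kerSubgroup he
  -- retype along the (definitional) identification `((2 : ℕ) : ℤ) = (2 : ℤ)` of the torsion exponents
  let e' : ↥((↥(W.geomPrimaryTorsion 2))[(2 : ℤ)]) ≃+ ↥((↥(A.geomPrimaryTorsion 2))[(2 : ℤ)]) := e'₀
  have he' : ∀ (σ : Field.absoluteGaloisGroup ℚ) (x : ↥((↥(W.geomPrimaryTorsion 2))[(2 : ℤ)])),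
      e' (σ • x) = σ • e' x := he'₀
  have hbij : Function.Bijective (pushH1 κ.kerSubgroup e'.toAddMonoidHom he') := hbij₀
  -- shorthand for the two Kummer maps
  set kW := pushH1 κ.kerSubgroup ((↥(W.geomPrimaryTorsion 2))[(2 : ℤ)]).subtype (subtype_torsionBy_smul W 2)
    with hkW
  set kA := pushH1 κ.kerSubgroup ((↥(A.geomPrimaryTorsion 2))[(2 : ℤ)]).subtype (subtype_torsionBy_smul A 2)
    with hkA
  set push := pushH1 κ.kerSubgroup e'.toAddMonoidHom he' with hpush
  -- R(A) finite
  have hRA : ((signedSelmerInfty A κ 1).comap kA :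
      Set (subgroupH1 κ.kerSubgroup ↥((↥(A.geomPrimaryTorsion 2))[(2 : ℤ)]))).Finite :=
    (finite_signedSelmerInfty_twoTorsion_iff_finite_comap A hssA κ 1).mp hfinA
  -- R♯(A) finite
  have hRsharpA := sel2L_cmFree A κ hκ S₀ hS2 hRA
  -- R♯(W) maps into R♯(A) under `push`
  set RW : Set (subgroupH1 κ.kerSubgroup ↥((↥(W.geomPrimaryTorsion 2))[(2 : ℤ)])) :=
    {c | c ∈ unramifiedOutside κ.kerSubgroup ↥((↥(W.geomPrimaryTorsion 2))[(2 : ℤ)]) 2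
          (↑S₀ : Set (HeightOneSpectrum (𝓞 ℚ))) ∧
        (∀ (w : InfinitePlace ℚ) (σ : Field.absoluteGaloisGroup ℚ),
          Literature.NumberTheory.EllipticCurves.conjH1 κ.kerSubgroup ↥((↥(W.geomPrimaryTorsion 2))[(2 : ℤ)]) σ c ∈
            GreenbergSelmer.infKer κ.kerSubgroup ↥((↥(W.geomPrimaryTorsion 2))[(2 : ℤ)]) w) ∧
        (∀ (v : HeightOneSpectrum (𝓞 ℚ)), ((2 : ℕ) : 𝓞 ℚ) ∈ v.asIdeal → ∀ σ : Field.absoluteGaloisGroup ℚ,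
          W.conjH1 2 κ.kerSubgroup σ (kW c) ∈
            localKummerOverOfEmb W 2 κ.kerSubgroup (closureEmb (K := ℚ) (v.adicCompletion ℚ))
              (⨆ n : ℕ, signedLocalPoints κ (v.adicCompletion ℚ) W 1 n))} with hRW_def
  have hmaps : RW ⊆ push ⁻¹' {c : subgroupH1 κ.kerSubgroup ↥((↥(A.geomPrimaryTorsion 2))[(2 : ℤ)]) |
      c ∈ unramifiedOutside κ.kerSubgroup ↥((↥(A.geomPrimaryTorsion 2))[(2 : ℤ)]) 2
          (↑S₀ : Set (HeightOneSpectrum (𝓞 ℚ))) ∧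
        (∀ (w : InfinitePlace ℚ) (σ : Field.absoluteGaloisGroup ℚ),
          Literature.NumberTheory.EllipticCurves.conjH1 κ.kerSubgroup ↥((↥(A.geomPrimaryTorsion 2))[(2 : ℤ)]) σ c ∈
            GreenbergSelmer.infKer κ.kerSubgroup ↥((↥(A.geomPrimaryTorsion 2))[(2 : ℤ)]) w) ∧
        (∀ (v : HeightOneSpectrum (𝓞 ℚ)), ((2 : ℕ) : 𝓞 ℚ) ∈ v.asIdeal → ∀ σ : Field.absoluteGaloisGroup ℚ,
          A.conjH1 2 κ.kerSubgroup σ (kA c) ∈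
            localKummerOverOfEmb A 2 κ.kerSubgroup (closureEmb (K := ℚ) (v.adicCompletion ℚ))
              (⨆ n : ℕ, signedLocalPoints κ (v.adicCompletion ℚ) A 1 n))} := by
    rintro c ⟨ha, hb, hc⟩
    refine ⟨?_, ?_, ?_⟩
    · exact pushH1_mem_unramifiedOutside κ.kerSubgroup e'.toAddMonoidHom he' 2 _ ha
    · intro w σ
      have h := pushH1_mem_infKer κ.kerSubgroup e'.toAddMonoidHom he' w (hb w σ)
      rw [pushH1_conjH1] at h
      exact h
    · exact sel2T_cmFree W A hssW ha2W hssA ha2A κ hκ e' he' c hc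
  have hRsharpW : RW.Finite := (hRsharpA.preimage hbij.1.injOn).subset hmaps
  have hRWfin : ((signedSelmerInfty W κ 1).comap kW :
      Set (subgroupH1 κ.kerSubgroup ↥((↥(W.geomPrimaryTorsion 2))[(2 : ℤ)]))).Finite := by
    refine hRsharpW.subset fun c hc ↦ ?_
    exact sel2U_negDisc W hΔ κ hκ S₀ hSW c hc
  exact (finite_signedSelmerInfty_twoTorsion_iff_finite_comap W hssW κ 1).mpr hRWfin

/-! ## The torsion-and-`μ` transport, CM-free -/

/-- **Torsion-and-`μ` transport at `2` along a `2`-congruence, CM-FREE (B. D. Kim 2009 Cor. 2.13 `μ`-half / Greenberg–Vatsal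
Thm. (1.4) READ AT `p = 2`).** For ANY two globally minimal elliptic `W`, `A` over `ℚ`, both good supersingular at `2` with `a₂ = 0`,
`Δ_W < 0`, a Galois-equivariant `e : W[2] ≃ A[2]`, a cyclotomic `κ` (any `γ`) and `+` signed Selmer dual data `D` of `W`, `D'` of `A`: if
`X⁺_A` is `Λ`-torsion with `μ = 0` then so is `X⁺_W`. Proof: `finite_quotient_of_muInvariant_eq_zero` ⇒ `X⁺_A/2` finite ⇒
(`finite_quotient_augIdealP_iff_finite_pTorsion`) `Sel⁺(A)[2]` finite ⇒ (`sel2_cmFree_negDisc`) `Sel⁺(W)[2]` finite ⇒ `X⁺_W/2` finite ⇒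
(`isTorsion_and_muInvariant_eq_zero_of_finite_quotient`) `X⁺_W` torsion with `μ = 0`. Compare `SSMazurTate.isTorsion_and_mu_eq_zero_of_cmPartner_two`
(p584588: the same on the TP2 habitat, `A` CM, via the CLOSED item 21414). [cite: BDKim2009, Cor. 2.13] [cite: GreenbergVatsal2000, Thm. (1.4) and Prop. (2.8)] -/
theorem isTorsion_and_mu_eq_zero_of_twoCongruence_negDisc
    (W : WeierstrassCurve ℚ) [W.IsElliptic] [W.IsGloballyMinimal] (hss : GoodSS W 2) (ha : W.frobeniusTrace 2 = 0)
    (hΔ : W.Δ < 0)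
    (A : WeierstrassCurve ℚ) [A.IsElliptic] [A.IsGloballyMinimal] (hAss : GoodSS A 2) (hAa : A.frobeniusTrace 2 = 0)
    (e : WeierstrassCurve.geomTorsion W (2 : ℤ) ≃+ WeierstrassCurve.geomTorsion A (2 : ℤ))
    (he : ∀ (σ : Field.absoluteGaloisGroup ℚ) (P : WeierstrassCurve.geomTorsion W (2 : ℤ)), e (σ • P) = σ • e P)
    (κ : ZpExtension ℚ 2) (γ : Field.absoluteGaloisGroup ℚ) (hκ : κ.IsCyclotomic)
    (D : SignedSelmerDualData W κ γ 1) (D' : SignedSelmerDualData A κ γ 1)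
    [Module.Finite (IwasawaAlgebra 2) D.X] [Module.Finite (IwasawaAlgebra 2) D'.X]
    (hXA : Module.IsTorsion (IwasawaAlgebra 2) D'.X) (hμA : D'.mu = 0) :
    Module.IsTorsion (IwasawaAlgebra 2) D.X ∧ D.mu = 0 := by
  have hfinA : Finite (D'.X ⧸ (augIdealP 2 • ⊤ : Submodule (IwasawaAlgebra 2) D'.X)) :=
    finite_quotient_of_muInvariant_eq_zero hXA hμA
  have hA : {s : signedSelmerInfty A κ 1 | (2 : ℕ) • s = 0}.Finite :=
    (finite_quotient_augIdealP_iff_finite_pTorsion D').mp hfinA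
  have hW : {s : signedSelmerInfty W κ 1 | (2 : ℕ) • s = 0}.Finite :=
    sel2_cmFree_negDisc W A hss ha hAss hAa hΔ ⟨e, he⟩ κ hκ hA
  have hfinW : Finite (D.X ⧸ (augIdealP 2 • ⊤ : Submodule (IwasawaAlgebra 2) D.X)) :=
    (finite_quotient_augIdealP_iff_finite_pTorsion D).mpr hW
  exact isTorsion_and_muInvariant_eq_zero_of_finite_quotient hfinW

/-- **The `μ`-transport display shape of the unit-anchor road, CM-FREE, for `Δ_E < 0`**: exactly the binder `hmuT` of GEN 4/5's
unit-anchor doors (`SSUnitAnchor.*`: «`X⁺(E)`, `X⁺(A)` torsion, `μ⁺(A) = 0 ⇒ μ⁺(E) = 0`» at a pair of `a₂ = 0` curves with `E[2] ≅ A[2]`),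
now a kernel term when `Δ_E < 0` (no CM, no analytic-rank hypothesis on either curve). [cite: BDKim2009, Cor. 2.13] -/
theorem muTransport_two_of_twoCongruence_negDisc
    (W : WeierstrassCurve ℚ) [W.IsElliptic] [W.IsGloballyMinimal] (hΔ : W.Δ < 0)
    (A : WeierstrassCurve ℚ) [A.IsElliptic] [A.IsGloballyMinimal] :
    GoodSS W 2 → W.frobeniusTrace 2 = 0 → GoodSS A 2 → A.frobeniusTrace 2 = 0 →
      (∃ e : WeierstrassCurve.geomTorsion W (2 : ℤ) ≃+ WeierstrassCurve.geomTorsion A (2 : ℤ),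
        ∀ (σ : Field.absoluteGaloisGroup ℚ) (P : WeierstrassCurve.geomTorsion W (2 : ℤ)), e (σ • P) = σ • e P) →
      ∀ (κ : ZpExtension ℚ 2) (γ : Field.absoluteGaloisGroup ℚ), κ.IsCyclotomic → κ.IsTopGenerator γ →
      ∀ (D : SignedSelmerDualData W κ γ 1) (D' : SignedSelmerDualData A κ γ 1)
        [Module.Finite (IwasawaAlgebra 2) D.X] [Module.Finite (IwasawaAlgebra 2) D'.X],
        Module.IsTorsion (IwasawaAlgebra 2) D.X → Module.IsTorsion (IwasawaAlgebra 2) D'.X →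
        D'.mu = 0 → D.mu = 0 := by
  intro hss ha hAss hAa hiso κ γ hκ _ D D' _ _ _ hXA hμA
  obtain ⟨e, he⟩ := hiso
  exact (isTorsion_and_mu_eq_zero_of_twoCongruence_negDisc W hss ha hΔ A hAss hAa e he κ γ hκ D D' hXA hμA).2

end TwoCongruence
end Summit.BirchSwinnertonDyer.BirchSwinnertonDyer.Theorems.SignedTransportAtTwo

end
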